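import Mathlib.Analysis.Calculus.FDeriv.Symmetric
import Mathlib.Topology.Algebra.Module.FiniteDimension
import Literature.Barriers.CriticalPhenomena.RigorousRGSmallParameterLocalPolynomial
import HarnessLib

/-!
# `RigorousRGSmallParameter` (Slade, Theorem 1.4.1): local field monomials `M_{m,a}` and their
# zero-field pairing with test functions — the first ingredient of the localisation operator
# `Loc` of [BS-rg-loc]

Companion ("proof architecture") file of
`Literature/Barriers/CriticalPhenomena/RigorousRGSmallParameter.lean`, on top of the `T_φ`
seminorm files (`…TphiSeminorm`, `…TphiCalculus`, `…TestFunctionNorm`, `…LocalPolynomial`).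
Slade's renormalisation-group map (§6.3, Theorem 6.3.1, whose output is the named fact
`LongRangePhi4.Slade2017_prop822`) is built in [BS-rg-step] from the localisation operator
`Loc_X` "defined and studied in [BS-rg-loc]" (Slade §4.2); `Loc_X F` is the local polynomial
`V(X)` with `⟨F, g⟩_0 = ⟨V(X), g⟩_0` for all polynomial test functions `g`
([BS-rg-loc], Proposition 1.3.1 and Definition 1.3.2), and its existence rests on the explicit
duality between the local field monomials `M_{m,a} = ∏_k ∇^{α_k}φ_{i_k}(a)` and polynomial test
functions, whose starting point is the zero-field pairing formula
`⟨M_{m,a}, g⟩_0 = ∇^m (Sg)_{a⃗}` ([BS-rg-loc], display (2.2)). This file formalizes, for the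
concrete model (one real boson species with `n` components on the torus `TorusSite d M`, field
space `Λ_N → ℝⁿ`, coordinate directions `basisDir`, unit steps `unitStep`):

* the local field monomials `M_{m,a}` as elements of `𝒩` (smooth functions of the field), for
  `m` a finite sequence of (component, multi-index) pairs, the multi-index being a list of the
  `2d` unit steps `±e_j` ([BS-rg-loc] (1.7)); and
* the zero-field pairing formula (2.2) in recursive ("one factor at a time") form:
  `⟨M_{c·m,a}, g⟩_0 = ⟨M_{m,a}, T_c g⟩_0`, where for `c = (i, α)` the slot contraction
  `(T_c g)_v = (|v|+1)⁻¹ Σ_{k=0}^{|v|} (∇^α_{z_k} g)_{(v_1,…,v_k,(a,i),v_{k+1},…)}` inserts the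
  point `(a,i)` in each slot, applies `∇^α` there and averages; iterating,
  `⟨M_{m,a}, g⟩_0 = (1/p!) Σ_σ ∇^{α_1}_{z_{σ1}}⋯∇^{α_p}_{z_{σp}} g` at `a⃗`, which is (2.2)
  (the symmetrisation `S` being produced by the average over slots).

Sources: D. C. Brydges, G. Slade, *A renormalisation group method. II. Approximation by local
polynomials*, J. Stat. Phys. 159 (2015) 461–491, arXiv:1403.7253 (read from the TeX source:
§1.2 displays (1.7)–(1.8), §2.1 display (2.2) "`⟨M_{m,a}, g⟩_0 = ∇^m(Sg)_{a⃗}`"); the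
coefficient/pairing calculus is that of [BS-rg-norm] (Brydges–Slade, J. Stat. Phys. 159 (2015)
421–460, §3.4 and §5.1: `F_z` symmetric under permutations; `⟨F ⋆ G, g⟩ = ⟨F, G^* g⟩`).

## What this file provides (definitions with proved properties; no named fact)

* Abstract calculus in `𝒩` (namespace `Tphi`): `dirDeriv_comm` (symmetry of second directional
  derivatives of a smooth function), **`coeff_perm`** (`F_{σz} = F_z`: the coefficients are
  symmetric in the sequence, [BS-rg-norm] §3.4), `coeff_dirDeriv`; coefficients of a continuous
  linear functional (`coeff_clm_singleton`, `coeff_clm_cons_cons`, `coeffFamily_clm`: at a zero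
  of `ℓ` the family is the one-letter family `single (ℓ ∘ e)`), `coeffFamily_one`; the
  single-letter shuffle average `shAvg_singleton` (`f_{(x),v}` = average over the insertions of
  `x` into `v`), `pairing_single_left`, `pairing_sum_right`, and **`pairing_star_single`**:
  `⟨single f ⋆ G, g⟩ = ⟨G, T_f g⟩` with `(T_f g)_v = (|v|+1)⁻¹ Σ_k Σ_x f(x) g_{v ⊲_k x}`.
* Lattice calculus (namespace `Loc`): iterated finite differences `fdiffs` (linear, and
  **commuting**: `fdiffs_perm`), the field derivatives `dfield α (x,i) : φ ↦ ∇^α φ^i_x` as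
  continuous linear functionals (`dfield_cons`, `dfield_perm`, `dfield_eq_napply` = the
  quantity normed by (6.29), `abs_dfield_le`: `|∇^α φ^i_x| ≤ 𝔥R^{-|α|}‖φ‖_{Φ(𝔥,R)}`).
* **`monomial m a = M_{m,a}`** ([BS-rg-loc] (1.7) evaluated at `a`), `contDiff_monomial`,
  `monomial_perm` ("permutations of the components of `m` give the same monomial" — one boson
  species), `monomial_apply_zero`.
* The slot contraction `slotOp a c` (`T_c`) with `sum_dfield_basisDir_mul`
  (`Σ_y (∇^α e_y)^i(a) h(y) = ∇^α h(·,i)(a)`), `napply_slot` (`∇^α` placed at slot `k` in the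
  programme calculus of `…TestFunctionNorm` is the difference in the inserted point),
  `slotOp_eq_zero_of_length`.
* **`TphiPairing_monomial_cons_zero`** (`⟨M_{c·m,a}, g⟩_0 = ⟨M_{m,a}, T_c g⟩_0`),
  `TphiPairing_monomial_nil` (`⟨M_∅, g⟩ = g_∅`), **`TphiPairing_monomial_zero`** (closed form:
  `⟨M_{m,a}, g⟩_0 = (T_{c_p} ∘ ⋯ ∘ T_{c_1} g)_∅`), and `coeffFamily_monomial_zero_eq_zero` (the
  zero-field coefficients of `M_{m,a}` live exactly in degree `p(m)`).

## References

* [BrydgesSlade2015RGII] D. C. Brydges, G. Slade, *A renormalisation group method. II.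
  Approximation by local polynomials*, J. Stat. Phys. 159 (2015) 461–491, arXiv:1403.7253 —
  §1.2 (local monomials (1.7)), §2.1 (display (2.2)).
* [BrydgesSlade2015RGI] D. C. Brydges, G. Slade, *A renormalisation group method. I. Gaussian
  integration and normed algebras*, J. Stat. Phys. 159 (2015) 421–460, arXiv:1403.7244 — §3.4,
  §5.1.
* [Slade2017] G. Slade, *Critical exponents for long-range O(n) models below the upper critical
  dimension*, Commun. Math. Phys. 358 (2018) 343–436, arXiv:1611.06169 — §4.2 (Loc), §6.2.1
  ((6.29)).
-/

noncomputable section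

namespace Literature.Barriers.CriticalPhenomena

namespace LongRangePhi4

namespace Tphi

open Finset

variable {Ξ : Type*}

section calculus

open scoped ContDiff

variable {E : Type*} [NormedAddCommGroup E] [NormedSpace ℝ E]

/-! ### Symmetry of the coefficients `F_z` in `z` -/

/-- **Directional derivatives of a smooth function commute**: `∂_u∂_v F = ∂_v∂_u F` (symmetry of
the second Fréchet derivative). [folklore] -/
theorem dirDeriv_comm {F : E → ℝ} (hF : ContDiff ℝ ∞ F) (u v : E) :
    dirDeriv u (dirDeriv v F) = dirDeriv v (dirDeriv u F) := by
  have hd : Differentiable ℝ F := differentiable_of_contDiff hF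
  have hd2 : Differentiable ℝ (fderiv ℝ F) :=
    ((contDiff_infty_iff_fderiv.1 hF).2).differentiable (by simp)
  -- `∂_u ∂_v F (φ) = D²F(φ)(u)(v)`
  have key : ∀ u v : E, dirDeriv u (dirDeriv v F) = fun φ => fderiv ℝ (fderiv ℝ F) φ u v := by
    intro u v
    funext φ
    have h : HasFDerivAt (fun ψ => fderiv ℝ F ψ v)
        ((ContinuousLinearMap.apply ℝ ℝ v).comp (fderiv ℝ (fderiv ℝ F) φ)) φ :=
      (ContinuousLinearMap.apply ℝ ℝ v).hasFDerivAt.comp φ (hd2 φ).hasFDerivAt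
    show fderiv ℝ (fun ψ => fderiv ℝ F ψ v) φ u = _
    rw [h.fderiv]
    rfl
  rw [key, key]
  funext φ
  exact second_derivative_symmetric (fun y => (hd y).hasFDerivAt) (hd2 φ).hasFDerivAt u v

/-- **The coefficients `F_z` are symmetric in `z`**: `F_{σz} = F_z` for every permutation of the
sequence (mixed partial derivatives of the smooth `F` commute) — built into `𝒩` in [BS-rg-norm]
(the coefficients "are symmetric under permutations"), and the reason why `⟨F, g⟩_φ = ⟨F, Sg⟩_φ`.
[cite: BrydgesSlade2015RGI, §3.4 (before Definition 3.4.1)] -/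
theorem coeff_perm (e : Ξ → E) {z z' : List Ξ} (h : z.Perm z') :
    ∀ {F : E → ℝ}, ContDiff ℝ ∞ F → coeff e z F = coeff e z' F := by
  induction h with
  | nil => intro F _; rfl
  | cons a _ ih => intro F hF; rw [coeff_cons, coeff_cons, ih hF]
  | swap a b l =>
      intro F hF
      rw [coeff_cons, coeff_cons, coeff_cons, coeff_cons]
      exact dirDeriv_comm (contDiff_coeff e hF l) (e b) (e a)
  | trans _ _ ih₁ ih₂ => intro F hF; rw [ih₁ hF, ih₂ hF]

/-- `F_{z·a} = (∂_{e_a}F)_z`: the last label is differentiated first. [folklore] -/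
theorem coeff_append_singleton (e : Ξ → E) (a : Ξ) : ∀ (z : List Ξ) (F : E → ℝ),
    coeff e (z ++ [a]) F = coeff e z (dirDeriv (e a) F)
  | [], _ => rfl
  | b :: z, F => by rw [List.cons_append, coeff_cons, coeff_cons, coeff_append_singleton e a z F]

/-- `(∂_{e_a}F)_z = F_{a·z}` for smooth `F`. [folklore] -/
theorem coeff_dirDeriv (e : Ξ → E) (a : Ξ) (z : List Ξ) {F : E → ℝ} (hF : ContDiff ℝ ∞ F) :
    coeff e z (dirDeriv (e a) F) = coeff e (a :: z) F := by
  rw [← coeff_append_singleton]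
  exact coeff_perm e (List.perm_append_singleton a z) hF

/-! ### Coefficients of a linear functional -/

/-- `∂_v ℓ = ℓ(v)` for a continuous linear functional. [folklore] -/
theorem dirDeriv_clm (ℓ : E →L[ℝ] ℝ) (v : E) : dirDeriv v (⇑ℓ) = fun _ => ℓ v := by
  funext φ
  simp [dirDeriv, ContinuousLinearMap.fderiv]

/-- `ℓ_{(a)} = ℓ(e_a)`. [folklore] -/
theorem coeff_clm_singleton (e : Ξ → E) (ℓ : E →L[ℝ] ℝ) (a : Ξ) :
    coeff e [a] (⇑ℓ) = fun _ => ℓ (e a) := by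
  rw [coeff_cons, coeff_nil, dirDeriv_clm]

/-- `ℓ_z = 0` for `|z| ≥ 2`. [folklore] -/
theorem coeff_clm_cons_cons (e : Ξ → E) (ℓ : E →L[ℝ] ℝ) (a b : Ξ) : ∀ z : List Ξ,
    coeff e (a :: b :: z) (⇑ℓ) = fun _ => 0
  | [] => by
      rw [coeff_cons, coeff_clm_singleton]
      funext φ; simp [dirDeriv]
  | c :: z => by
      rw [coeff_cons, coeff_clm_cons_cons e ℓ b c z]
      funext φ; simp [dirDeriv]

/-- A one-letter family: `f` on sequences of length one, `0` elsewhere. [folklore] -/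
def single (f : Ξ → ℝ) : List Ξ → ℝ
  | [x] => f x
  | _ => 0

/-- `single f (x) = f x`. [folklore] -/
@[simp] theorem single_singleton (f : Ξ → ℝ) (x : Ξ) : single f [x] = f x := rfl

/-- `single f ∅ = 0`. [folklore] -/
@[simp] theorem single_nil (f : Ξ → ℝ) : single f [] = 0 := rfl

/-- `single f z = 0` for `|z| ≥ 2`. [folklore] -/
@[simp] theorem single_cons_cons (f : Ξ → ℝ) (a b : Ξ) (z : List Ξ) : single f (a :: b :: z) = 0 := rfl

/-- `single f z = 0` unless `|z| = 1`. [folklore] -/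
theorem single_eq_zero_of_length (f : Ξ → ℝ) : ∀ {z : List Ξ}, z.length ≠ 1 → single f z = 0
  | [], _ => rfl
  | [_], h => absurd rfl h
  | _ :: _ :: _, _ => rfl

/-- **The coefficient family of a linear functional at a zero of it** is the one-letter family
`(a) ↦ ℓ(e_a)`. [folklore] -/
theorem coeffFamily_clm (e : Ξ → E) (ℓ : E →L[ℝ] ℝ) {φ : E} (hφ : ℓ φ = 0) :
    coeffFamily e (⇑ℓ) φ = single (fun a => ℓ (e a)) := by
  funext z
  match z with
  | [] => simpa [coeffFamily] using hφ
  | [a] => simp [coeffFamily, coeff_clm_singleton]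
  | a :: b :: z => simp [coeffFamily, coeff_clm_cons_cons]

/-- The coefficient family of the constant `1` is the indicator of the empty sequence. [folklore] -/
theorem coeffFamily_one (e : Ξ → E) (φ : E) :
    coeffFamily e (fun _ : E => (1 : ℝ)) φ = fun z => if z = [] then 1 else 0 := by
  funext z
  by_cases hz : z = []
  · subst hz; simp [coeffFamily]
  · simp [coeffFamily, LocalPoly.coeff_const_eq_zero e 1 z hz, hz]

end calculus

/-! ### `⋆` with a one-letter family and the pairing; single-letter shuffle averages -/

/-- `star (single f) G` vanishes on sequences whose length is not `|·| + 1` of the support of `G`: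
if `G` vanishes on length `r` then `single f ⋆ G` vanishes on length `r + 1`. [folklore] -/
theorem star_single_eq_zero_of_length (f : Ξ → ℝ) (G : List Ξ → ℝ) {r : ℕ}
    (hG : ∀ w : List Ξ, w.length = r → G w = 0) {z : List Ξ} (hz : z.length = r + 1) :
    star (single f) G z = 0 := by
  simp only [Tphi.star]
  rw [List.sum_eq_zero]
  intro t ht
  rw [List.mem_map] at ht
  obtain ⟨p, hp, rfl⟩ := ht
  have hlen := length_add_of_mem_splits hp
  by_cases h1 : p.1.length = 1
  · rw [hG p.2 (by omega), mul_zero]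
  · rw [single_eq_zero_of_length f h1, zero_mul]

/-- Merging the empty sequence along the all-`false` mask returns the second sequence. [folklore] -/
theorem merge_replicate_false_nil : ∀ w : List Ξ, merge (List.replicate w.length false) [] w = w
  | [] => rfl
  | b :: w => by
      rw [List.length_cons, List.replicate_succ, merge_false_cons, merge_replicate_false_nil w]

/-- The interleavings of a one-letter sequence `(x)` with `v` are the insertions of `x` into `v`:
`Σ_{m ∈ masks 1 |v|} g(merge m (x) v) = Σ_{k ≤ |v|} g(v with x inserted at slot k)`. [folklore] -/
theorem sum_masks_one (x : Ξ) : ∀ (v : List Ξ) (g : List Ξ → ℝ),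
    ((masks 1 v.length).map fun m => g (merge m [x] v)).sum =
      ∑ k ∈ range (v.length + 1), g (v.insertIdx k x)
  | [], g => by simp [masks_succ_zero, merge]
  | b :: v, g => by
      rw [List.length_cons, masks_succ_succ, List.map_append, List.sum_append, List.map_map,
        List.map_map, masks_zero, List.map_singleton, List.sum_singleton, Function.comp_apply,
        merge_true_cons]
      have h1 : merge (List.replicate (v.length + 1) false) ([] : List Ξ) (b :: v) = b :: v := by
        simpa using merge_replicate_false_nil (b :: v)
      rw [h1, Finset.sum_range_succ' _ (v.length + 1), List.insertIdx_zero]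
      rw [add_comm]
      congr 1
      have h2 : ((fun m => g (merge m [x] (b :: v))) ∘ (List.cons false)) =
          fun m => (fun w => g (b :: w)) (merge m [x] v) := by
        funext m
        simp
      rw [h2, sum_masks_one x v (fun w => g (b :: w))]
      rfl

/-- **The shuffle average with a one-letter sequence**:
`f_{(x),v} = (|v|+1)⁻¹ Σ_{k=0}^{|v|} g_{(v_1,…,v_k,x,v_{k+1},…)}`. [folklore] -/
theorem shAvg_singleton (g : List Ξ → ℝ) (x : Ξ) (v : List Ξ) :
    shAvg g [x] v = ((v.length + 1 : ℕ) : ℝ)⁻¹ * ∑ k ∈ range (v.length + 1), g (v.insertIdx k x) := by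
  unfold shAvg
  rw [List.length_singleton, sum_masks_one, Nat.choose_one_right, add_comm 1 v.length,
    div_eq_inv_mul]

variable [Fintype Ξ]

/-- The pairing is additive over finite sums of test functions. [folklore] -/
theorem pairing_sum_right {β : Type*} (pN : ℕ) (F : List Ξ → ℝ) (s : Finset β)
    (g : β → List Ξ → ℝ) :
    pairing pN F (fun z => ∑ i ∈ s, g i z) = ∑ i ∈ s, pairing pN F (g i) := by
  classical
  induction s using Finset.induction_on with
  | empty => simp [pairing_zero_right]
  | insert b s hb ih =>
      rw [Finset.sum_insert hb, ← ih, ← pairing_add_right]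
      congr 1
      funext z
      rw [Finset.sum_insert hb]

/-- **Pairing with a one-letter family**: `⟨single f, h⟩ = Σ_x f(x) h_{(x)}` (`p_𝒩 ≥ 1`). [folklore] -/
theorem pairing_single_left {pN : ℕ} (hpN : 1 ≤ pN) (f : Ξ → ℝ) (h : List Ξ → ℝ) :
    pairing pN (single f) h = ∑ x, f x * h [x] := by
  unfold pairing
  rw [Finset.sum_eq_single 1]
  · simp [sumSeq_succ]
  · intro r _ hr
    rw [sumSeq_congr r (g := fun _ => 0), sumSeq_zero_fun, mul_zero]
    intro z hz
    rw [single_eq_zero_of_length f (by omega), zero_mul]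
  · intro h1
    exact absurd (Finset.mem_range.2 (by omega)) h1

/-- **`⟨single f ⋆ G, g⟩ = ⟨G, T_f g⟩`** with
`(T_f g)_v = (|v|+1)⁻¹ Σ_{k=0}^{|v|} Σ_x f(x) g_{(v_1,…,v_k,x,v_{k+1},…)}`: the adjoint of
left-`⋆`-multiplication by a one-letter family contracts `f` into each slot (from
`⟨F ⋆ G, g⟩ = ⟨F, G^*g⟩`, display (Gadj) of [BS-rg-norm]). [cite: BrydgesSlade2015RGI, §5.1 (proof of Proposition 5.1.2)] -/
theorem pairing_star_single {pN : ℕ} (hpN : 1 ≤ pN) (f : Ξ → ℝ) (G g : List Ξ → ℝ)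
    (hg : ∀ z, pN < z.length → g z = 0) :
    pairing pN (star (single f) G) g =
      pairing pN G (fun v => ((v.length + 1 : ℕ) : ℝ)⁻¹ *
        ∑ k ∈ range (v.length + 1), ∑ x, f x * g (v.insertIdx k x)) := by
  rw [pairing_star pN _ _ _ hg, pairing_single_left hpN]
  simp only [adj]
  have h : ∀ x, f x * pairing pN G (fun v => shAvg g [x] v) =
      pairing pN G (fun v => f x * shAvg g [x] v) := fun x => (pairing_smul_right pN G _ (f x)).symm
  simp only [h]
  rw [← pairing_sum_right]
  congr 1
  funext v
  simp only [shAvg_singleton, Finset.mul_sum]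
  rw [Finset.sum_comm]
  refine Finset.sum_congr rfl fun k _ => Finset.sum_congr rfl fun x _ => ?_
  ring

end Tphi

/-! ## Local field monomials on the torus -/

namespace Loc

open Finset Tphi RGNorm LocalPoly Literature.Probability.LatticeModels
open scoped ContDiff

variable {d M n : ℕ} [NeZero M]

/-! ### Iterated finite differences of lattice functions -/

/-- Iterated finite differences `∇^{s_1}⋯∇^{s_r} f` of a lattice function, `∇^s f(x) = f(x+s) - f(x)`.
[cite: BrydgesSlade2015RGI, §3.3 (display defining ∇^α)] -/
def fdiffs (l : List (TorusSite d M)) (f : TorusSite d M → ℝ) : TorusSite d M → ℝ :=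
  l.foldr (fun s h x => h (x + s) - h x) f

omit [NeZero M] in
/-- `∇^∅ f = f`. [folklore] -/
@[simp] theorem fdiffs_nil (f : TorusSite d M → ℝ) : fdiffs [] f = f := rfl

omit [NeZero M] in
/-- `∇^{s·l} f = ∇^s (∇^l f)`. [folklore] -/
theorem fdiffs_cons (s : TorusSite d M) (l : List (TorusSite d M)) (f : TorusSite d M → ℝ) :
    fdiffs (s :: l) f = fun x => fdiffs l f (x + s) - fdiffs l f x := rfl

omit [NeZero M] in
/-- `∇^l (f + g) = ∇^l f + ∇^l g`. [folklore] -/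
theorem fdiffs_add : ∀ (l : List (TorusSite d M)) (f g : TorusSite d M → ℝ),
    fdiffs l (fun x => f x + g x) = fun x => fdiffs l f x + fdiffs l g x
  | [], _, _ => rfl
  | s :: l, f, g => by
      funext x
      simp only [fdiffs_cons, fdiffs_add l f g]
      ring

omit [NeZero M] in
/-- `∇^l (c f) = c ∇^l f`. [folklore] -/
theorem fdiffs_const_mul : ∀ (l : List (TorusSite d M)) (c : ℝ) (f : TorusSite d M → ℝ),
    fdiffs l (fun x => c * f x) = fun x => c * fdiffs l f x
  | [], _, _ => rfl
  | s :: l, c, f => by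
      funext x
      simp only [fdiffs_cons, fdiffs_const_mul l c f]
      ring

omit [NeZero M] in
/-- **Finite differences commute**: `∇^l f` depends only on the multiset of steps. [folklore] -/
theorem fdiffs_perm {l l' : List (TorusSite d M)} (h : l.Perm l') :
    ∀ f : TorusSite d M → ℝ, fdiffs l f = fdiffs l' f := by
  induction h with
  | nil => intro f; rfl
  | cons s _ ih => intro f; rw [fdiffs_cons, fdiffs_cons, ih f]
  | swap s t l =>
      intro f
      funext x
      simp only [fdiffs_cons]
      rw [add_right_comm x t s]
      ring
  | trans _ _ ih₁ ih₂ => intro f; rw [ih₁ f, ih₂ f]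

/-! ### The derivatives of the field as linear functionals, and the local monomials `M_{m,a}` -/

/-- `φ ↦ ∇^α φ^i_x` (`α` a list of unit steps `±e_j`) as a linear functional of the field. [folklore] -/
def dfieldLM (l : List (Fin d × Bool)) (p : TorusSite d M × Fin n) :
    (TorusSite d M → Fin n → ℝ) →ₗ[ℝ] ℝ where
  toFun φ := fdiffs (l.map (unitStep d M)) (fun x => φ x p.2) p.1
  map_add' φ ψ := by
    show fdiffs _ (fun x => φ x p.2 + ψ x p.2) p.1 = _
    rw [fdiffs_add]
  map_smul' c φ := by
    show fdiffs _ (fun x => c * φ x p.2) p.1 = _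
    rw [fdiffs_const_mul]
    rfl

/-- **`∇^α φ^i_x` as a continuous linear functional of the field** — the factors of the local
monomials (1.7) of [BS-rg-loc]. [cite: BrydgesSlade2015RGII, §1.2 (display (1.7), M_m = ∏_k ∇^{α_k}φ_{i_k})] -/
def dfield (l : List (Fin d × Bool)) (p : TorusSite d M × Fin n) : (TorusSite d M → Fin n → ℝ) →L[ℝ] ℝ :=
  { dfieldLM l p with cont := (dfieldLM (n := n) l p).continuous_of_finiteDimensional }

/-- The value `∇^α φ^i_x`. [folklore] -/
theorem dfield_apply (l : List (Fin d × Bool)) (p : TorusSite d M × Fin n) (φ : TorusSite d M → Fin n → ℝ) :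
    dfield l p φ = fdiffs (l.map (unitStep d M)) (fun x => φ x p.2) p.1 := rfl

/-- `∇^∅ φ^i_x = φ^i_x`. [folklore] -/
@[simp] theorem dfield_nil (p : TorusSite d M × Fin n) (φ : TorusSite d M → Fin n → ℝ) :
    dfield [] p φ = φ p.1 p.2 := rfl

/-- `∇^{s·α} φ^i_x = ∇^α φ^i_{x+s} - ∇^α φ^i_x`. [folklore] -/
theorem dfield_cons (s : Fin d × Bool) (l : List (Fin d × Bool)) (x : TorusSite d M) (i : Fin n)
    (φ : TorusSite d M → Fin n → ℝ) :
    dfield (s :: l) (x, i) φ = dfield l (x + unitStep d M s, i) φ - dfield l (x, i) φ := rfl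

/-- `∇^α φ^i_x` depends only on the multiset of steps in `α`. [folklore] -/
theorem dfield_perm {l l' : List (Fin d × Bool)} (h : l.Perm l') (p : TorusSite d M × Fin n) :
    dfield l p = dfield l' p := by
  apply ContinuousLinearMap.ext
  intro φ
  rw [dfield_apply, dfield_apply, fdiffs_perm (h.map _)]

/-- **The local field monomial `M_{m,a} = ∏_k ∇^{α_k} φ_{i_k}` evaluated at the point `a`**, for a
finite sequence `m = ((i_1,α_1),…,(i_p,α_p))` of (component, multi-index) pairs, as a function of
the field (an element of `𝒩`); `M_∅ = 1`. [cite: BrydgesSlade2015RGII, §1.2 (display (1.7)) and §2.1 ("M_m determines M_{m,a} ∈ 𝒩 by evaluation at a")] -/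
def monomial (m : List (Fin n × List (Fin d × Bool))) (a : TorusSite d M) :
    (TorusSite d M → Fin n → ℝ) → ℝ :=
  fun φ => (m.map fun c => dfield c.2 (a, c.1) φ).prod

/-- `M_∅ = 1`. [cite: BrydgesSlade2015RGII, §1.2 ("we set M_∅ = 1")] -/
@[simp] theorem monomial_nil (a : TorusSite d M) :
    monomial ([] : List (Fin n × List (Fin d × Bool))) a = fun _ => 1 := by
  funext φ; simp [monomial]

/-- `M_{c·m,a} = (∇^{α}φ_{i})(a) · M_{m,a}` for `c = (i, α)`. [folklore] -/
theorem monomial_cons (c : Fin n × List (Fin d × Bool)) (m : List (Fin n × List (Fin d × Bool)))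
    (a : TorusSite d M) : monomial (c :: m) a = fun φ => dfield c.2 (a, c.1) φ * monomial m a φ := by
  funext φ; simp [monomial]

/-- Local monomials are smooth functions of the field. [folklore] -/
theorem contDiff_monomial : ∀ (m : List (Fin n × List (Fin d × Bool))) (a : TorusSite d M),
    ContDiff ℝ ∞ (monomial m a)
  | [], a => by rw [monomial_nil]; exact contDiff_const
  | c :: m, a => by
      rw [monomial_cons]
      exact (dfield c.2 (a, c.1)).contDiff.mul (contDiff_monomial m a)

/-- "Permutations of the order of the components of `m` give … the same monomial" (one boson
species: no signs). [cite: BrydgesSlade2015RGII, §1.2 (after display (1.8))] -/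
theorem monomial_perm {m m' : List (Fin n × List (Fin d × Bool))} (h : m.Perm m') (a : TorusSite d M) :
    monomial m a = monomial m' a := by
  funext φ
  exact (h.map fun c => dfield c.2 (a, c.1) φ).prod_eq

/-- A monomial of positive degree vanishes at the zero field. [folklore] -/
theorem monomial_apply_zero (c : Fin n × List (Fin d × Bool)) (m : List (Fin n × List (Fin d × Bool)))
    (a : TorusSite d M) : monomial (c :: m) a 0 = 0 := by
  rw [monomial_cons]
  simp

/-! ### Contraction of a slot of a test function with `∇^α` at `a` -/

omit [NeZero M] in
/-- The coordinate direction `e_{(y,j)}` evaluated: `(e_{(y,j)})^i_x = 𝟙{(x,i) = (y,j)}`. [folklore] -/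
theorem basisDir_apply (y : TorusSite d M × Fin n) (x : TorusSite d M) (i : Fin n) :
    basisDir d M n y x i = if x = y.1 ∧ i = y.2 then 1 else 0 := rfl

/-- **Summation against the lattice delta functions reproduces `∇^α`**:
`Σ_y (∇^α e_y)^i(a) h(y) = (∇^α h(·, i))(a)`. [folklore] -/
theorem sum_dfield_basisDir_mul : ∀ (l : List (Fin d × Bool)) (a : TorusSite d M) (i : Fin n)
    (h : TorusSite d M × Fin n → ℝ),
    ∑ y, dfield l (a, i) (basisDir d M n y) * h y = fdiffs (l.map (unitStep d M)) (fun x => h (x, i)) a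
  | [], a, i, h => by
      simp only [dfield_nil, basisDir_apply, List.map_nil, fdiffs_nil]
      rw [Finset.sum_eq_single (a, i)]
      · simp
      · rintro ⟨y, j⟩ _ hne
        rw [ite_mul, one_mul, zero_mul, if_neg]
        rintro ⟨rfl, rfl⟩
        exact hne rfl
      · intro h; exact absurd (Finset.mem_univ _) h
  | s :: l, a, i, h => by
      simp only [dfield_cons, sub_mul, Finset.sum_sub_distrib, sum_dfield_basisDir_mul l,
        List.map_cons, fdiffs_cons]

omit [NeZero M] in
/-- Shifting the inserted letter: modifying slot `k` of `v` with `y` inserted at `k` modifies `y`. [folklore] -/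
theorem modify_insertIdx {α : Type*} (f : α → α) : ∀ (k : ℕ) (v : List α) (y : α), k ≤ v.length →
    (v.insertIdx k y).modify k f = v.insertIdx k (f y)
  | 0, v, y, _ => by simp
  | k + 1, [], y, h => by simp at h
  | k + 1, b :: v, y, h => by
      rw [List.insertIdx_succ_cons, List.insertIdx_succ_cons, List.modify_succ_cons,
        modify_insertIdx f k v y (by simpa using h)]

omit [NeZero M] in
/-- **`∇^α` in slot `k`**: the programme `α` placed at argument `k` of a test function, evaluated on
`v` with `(a,i)` inserted at slot `k`, is the iterated difference in the inserted point:
`(∇^α_{z_k} g)_{(v_1,…,(a,i),…)} = ∇^α (x ↦ g_{(v_1,…,(x,i),…)})(a)`. [folklore] -/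
theorem napply_slot : ∀ (l : List (Fin d × Bool)) (k : ℕ) (g : List (TorusSite d M × Fin n) → ℝ)
    (v : List (TorusSite d M × Fin n)) (a : TorusSite d M) (i : Fin n), k ≤ v.length →
    napply (unitStep d M) (l.map fun s => (k, s)) g (v.insertIdx k (a, i)) =
      fdiffs (l.map (unitStep d M)) (fun x => g (v.insertIdx k (x, i))) a
  | [], k, g, v, a, i, _ => rfl
  | s :: l, k, g, v, a, i, hk => by
      rw [List.map_cons, napply_cons, List.map_cons, fdiffs_cons]
      simp only [diffOp, shiftAt]
      rw [modify_insertIdx _ k v (a, i) hk, napply_slot l k g v _ i hk, napply_slot l k g v a i hk]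

/-- **The slot-contraction operator** `T_c` (`c = (i, α)`):
`(T_c g)_v = (|v|+1)⁻¹ Σ_{k=0}^{|v|} (∇^α_{z_k} g)_{(v_1,…,v_k,(a,i),v_{k+1},…)}` — insert the point
`(a,i)` in each slot, apply `∇^α` there, and average over the slots. [folklore] -/
def slotOp (a : TorusSite d M) (c : Fin n × List (Fin d × Bool)) (g : List (TorusSite d M × Fin n) → ℝ) :
    List (TorusSite d M × Fin n) → ℝ :=
  fun v => ((v.length + 1 : ℕ) : ℝ)⁻¹ *
    ∑ k ∈ range (v.length + 1), napply (unitStep d M) (c.2.map fun s => (k, s)) g (v.insertIdx k (a, c.1))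

omit [NeZero M] in
/-- `∇^β g` vanishes at `z` when `g` vanishes on all sequences of length `|z|`. [folklore] -/
theorem napply_eq_zero_of_length {S : Type*} (step : S → TorusSite d M) :
    ∀ (β : List (ℕ × S)) (g : List (TorusSite d M × Fin n) → ℝ) (z : List (TorusSite d M × Fin n)),
    (∀ w : List (TorusSite d M × Fin n), w.length = z.length → g w = 0) → napply step β g z = 0
  | [], g, z, h => h z rfl
  | q :: β, g, z, h => by
      rw [napply_cons]
      simp only [diffOp]
      rw [napply_eq_zero_of_length step β g _ (fun w hw => h w (by simpa [shiftAt] using hw)),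
        napply_eq_zero_of_length step β g z h, sub_zero]

omit [NeZero M] in
/-- `T_c` preserves vanishing beyond length `p_𝒩`. [folklore] -/
theorem slotOp_eq_zero_of_length {pN : ℕ} (a : TorusSite d M) (c : Fin n × List (Fin d × Bool))
    {g : List (TorusSite d M × Fin n) → ℝ} (hg : ∀ z, pN < z.length → g z = 0)
    (v : List (TorusSite d M × Fin n)) (hv : pN < v.length) : slotOp a c g v = 0 := by
  unfold slotOp
  rw [Finset.sum_eq_zero, mul_zero]
  intro k hk
  rw [Finset.mem_range] at hk
  refine napply_eq_zero_of_length _ _ g _ fun w hw => hg w ?_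
  rw [hw, List.length_insertIdx_of_le_length (by omega)]
  omega

/-! ### The zero-field pairing of a local monomial with a test function -/

/-- The coefficient family of `M_{c·m,a}` at zero field: `single(∇^{α}e_·(a)) ⋆ (M_{m,a})_·(0)`. [folklore] -/
theorem coeffFamily_monomial_cons_zero (c : Fin n × List (Fin d × Bool))
    (m : List (Fin n × List (Fin d × Bool))) (a : TorusSite d M) :
    coeffFamily (basisDir d M n) (monomial (c :: m) a) 0 =
      star (single fun y => dfield c.2 (a, c.1) (basisDir d M n y))
        (coeffFamily (basisDir d M n) (monomial m a) 0) := by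
  rw [monomial_cons, coeffFamily_mul _ (dfield c.2 (a, c.1)).contDiff (contDiff_monomial m a),
    coeffFamily_clm _ _ (by simp)]

/-- **Recursion for the zero-field pairing of a local monomial** (the bosonic content of
`⟨M_{m,a}, g⟩_0 = ∇^m(Sg)_{a⃗}`, display (2.2) of [BS-rg-loc]):
`⟨M_{c·m,a}, g⟩_0 = ⟨M_{m,a}, T_c g⟩_0` with the slot contraction `T_c`. Iterating,
`⟨M_{m,a}, g⟩_0 = (1/p!) Σ_σ (∇^{α_1}_{z_{σ1}}⋯∇^{α_p}_{z_{σp}} g)` at `z = ((a,i_{σ⁻¹1}),…)`, the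
symmetrised `p`-fold derivative of `g` at `a⃗`. [cite: BrydgesSlade2015RGII, §2.1 (display (2.2))] -/
theorem TphiPairing_monomial_cons_zero {pN : ℕ} (hpN : 1 ≤ pN) (c : Fin n × List (Fin d × Bool))
    (m : List (Fin n × List (Fin d × Bool))) (a : TorusSite d M)
    {g : List (TorusSite d M × Fin n) → ℝ} (hg : ∀ z, pN < z.length → g z = 0) :
    TphiPairing pN (basisDir d M n) (monomial (c :: m) a) 0 g =
      TphiPairing pN (basisDir d M n) (monomial m a) 0 (slotOp a c g) := by
  unfold TphiPairing
  rw [coeffFamily_monomial_cons_zero, pairing_star_single hpN _ _ _ hg]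
  congr 1
  funext v
  unfold slotOp
  congr 1
  refine Finset.sum_congr rfl fun k hk => ?_
  rw [Finset.mem_range] at hk
  rw [sum_dfield_basisDir_mul, napply_slot _ _ _ _ _ _ (by omega)]

/-- `⟨M_∅, g⟩_0 = ⟨1, g⟩_0 = g_∅`. [folklore] -/
theorem TphiPairing_monomial_nil (pN : ℕ) (a : TorusSite d M) (φ : TorusSite d M → Fin n → ℝ)
    (g : List (TorusSite d M × Fin n) → ℝ) :
    TphiPairing pN (basisDir d M n) (monomial ([] : List (Fin n × List (Fin d × Bool))) a) φ g = g [] := by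
  unfold TphiPairing
  rw [monomial_nil, coeffFamily_one]
  unfold pairing
  rw [Finset.sum_eq_single 0]
  · simp
  · intro r _ hr
    rw [sumSeq_congr r (g := fun _ => 0), sumSeq_zero_fun, mul_zero]
    intro z hz
    have : z ≠ [] := by rintro rfl; exact hr (by simpa using hz.symm)
    simp [this]
  · intro h; simp at h

/-- **The zero-field pairing of `M_{m,a}` in closed form**: iterate the slot contractions over the
components of `m` and evaluate at the empty sequence,
`⟨M_{m,a}, g⟩_0 = (T_{c_p} ∘ ⋯ ∘ T_{c_1} g)_∅` for `m = (c_1,…,c_p)`. [cite: BrydgesSlade2015RGII, §2.1 (display (2.2))] -/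
theorem TphiPairing_monomial_zero {pN : ℕ} (hpN : 1 ≤ pN) (a : TorusSite d M) :
    ∀ (m : List (Fin n × List (Fin d × Bool))) {g : List (TorusSite d M × Fin n) → ℝ},
    (∀ z, pN < z.length → g z = 0) →
    TphiPairing pN (basisDir d M n) (monomial m a) 0 g = (m.foldl (fun h c => slotOp a c h) g) []
  | [], g, _ => by rw [List.foldl_nil, TphiPairing_monomial_nil]
  | c :: m, g, hg => by
      rw [TphiPairing_monomial_cons_zero hpN c m a hg, List.foldl_cons,
        TphiPairing_monomial_zero hpN a m (slotOp_eq_zero_of_length a c hg)]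

/-- The coefficients of `M_{m,a}` at zero field live in degree `p(m)` exactly. [folklore] -/
theorem coeffFamily_monomial_zero_eq_zero : ∀ (m : List (Fin n × List (Fin d × Bool))) (a : TorusSite d M)
    (z : List (TorusSite d M × Fin n)), z.length ≠ m.length →
    coeffFamily (basisDir d M n) (monomial m a) 0 z = 0
  | [], a, z, hz => by
      rw [monomial_nil, coeffFamily_one]
      have : z ≠ [] := by rintro rfl; exact hz rfl
      simp [this]
  | c :: m, a, z, hz => by
      rw [coeffFamily_monomial_cons_zero]
      -- `single ⋆ G` with `G` supported in degree `|m|` is supported in degree `|m| + 1`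
      simp only [Tphi.star]
      rw [List.sum_eq_zero]
      intro t ht
      rw [List.mem_map] at ht
      obtain ⟨p, hp, rfl⟩ := ht
      have hlen := length_add_of_mem_splits hp
      by_cases h1 : p.1.length = 1
      · rw [coeffFamily_monomial_zero_eq_zero m a p.2 (by simp at hz; omega), mul_zero]
      · rw [single_eq_zero_of_length _ h1, zero_mul]

/-! ### Link with the field norm (6.29) -/

/-- The factors of the monomials are the quantities normed by `‖φ‖_{Φ_j}`:
`∇^α φ^i_x = (∇^α φ)_{(x,i)}` in the test-function calculus of `…TestFunctionNorm`. [folklore] -/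
theorem dfield_eq_napply (l : List (Fin d × Bool)) (x : TorusSite d M) (i : Fin n)
    (φ : TorusSite d M → Fin n → ℝ) :
    dfield l (x, i) φ = napply (unitStep d M) (prog1 l) (liftFn (fieldFn φ)) [(x, i)] := by
  have h := napply_slot l 0 (liftFn (fieldFn φ)) [] x i le_rfl
  simp only [List.insertIdx_zero] at h
  unfold prog1
  rw [h, dfield_apply]
  rfl

/-- **`|∇^α φ^i_x| ≤ 𝔥 R^{-|α|} ‖φ‖_{Φ(𝔥,R)}`** for `|α| ≤ p_Φ`. [cite: Slade2017, §6.2.1 (display (6.29))] -/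
theorem abs_dfield_le {𝔥 R : ℝ} (h𝔥 : 0 < 𝔥) (hR : 0 < R) {pΦ : ℕ} {l : List (Fin d × Bool)}
    (hl : l.length ≤ pΦ) (x : TorusSite d M) (i : Fin n) (φ : TorusSite d M → Fin n → ℝ) :
    |dfield l (x, i) φ| ≤ 𝔥 * (R ^ l.length)⁻¹ * fieldNorm 𝔥 R pΦ φ := by
  rw [dfield_eq_napply]
  have h := le_fieldNorm (𝔥 := 𝔥) (R := R) φ (x, i) hl
  have hRl : 0 < R ^ l.length := pow_pos hR _
  calc |napply (unitStep d M) (prog1 l) (liftFn (fieldFn φ)) [(x, i)]|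
      = 𝔥 * (R ^ l.length)⁻¹ *
          (𝔥⁻¹ * R ^ l.length * |napply (unitStep d M) (prog1 l) (liftFn (fieldFn φ)) [(x, i)]|) := by
        field_simp
    _ ≤ 𝔥 * (R ^ l.length)⁻¹ * fieldNorm 𝔥 R pΦ φ := mul_le_mul_of_nonneg_left h (by positivity)

end Loc

end LongRangePhi4

end Literature.Barriers.CriticalPhenomena

end
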